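/-
Copyright (c) 2026 the pub-hodgecm-mathlib formalisation cell (harness21).  Prover seat hodgecm-mathlib-K2E1-p11 (g2), Track B ∕ K2-LIT, h413 =
`stmt-HodgeConjecture-24833`, line `K2_E1_TraceFormulaBeta`, 5Res campaign «ENDGAME BY FAMILIES» ∕ ROADCARD §3′ (M2 v2), deal (272) part 1: the PAYER of the letter `hadjΘ`
(`R(η)†(Θ) ⊆ Θ`) of ★ (y2) `hU_offDual_global_cm_two` ∕ the self-dual all-of-`H` edition — from `R(η)† = R(η*)` (★ `adjoint_integratedOperator`) and the generator relations (★ B2 §0);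
for a symmetric real `η` (the convData ∕ positive-type kernels) `R(η)` is self-adjoint (★ `adjoint_integratedOperator_rightRegular_of_symm`) and `hadjΘ` IS `R(η)(Θ) ⊆ Θ`.
-/
import Summits.HodgeConjecture.HodgeConjecture.Theorems.K2E1ChiSectionHeckeIntertwiningCMTwo    -- ★ (x1) FILE B2 p860634 (this seat): §0 `apply_mem_topologicalClosure_span_of_generators`
import Summits.HodgeConjecture.HodgeConjecture.Theorems.K2E1BLUniquenessSelfAdjointU2            -- ★ (K2-defs1): `adjoint_integratedOperator_rightRegular_of_symm` (R(η)† = R(η) for symmetric real η)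
import HarnessLib

/-!
# (272)/1 — `K2E1HeckeAdjointStableCMTwo`: the payer of `hadjΘ : R(η)†(Θ) ⊆ Θ`

Cell `pub/hodgecm-mathlib`, crux H413 = `stmt-HodgeConjecture-24833`, route `HCCMUnconditional`; dealer K2E1-plan (g7) deal (272) («`hadjΘ` paid (★ `adjoint_integratedOperator` + ★ B2 §0 on η*)»).
THEOREMS ONLY (no `def` ∕ `instance` ∕ `notation` ∕ named-fact hypothesis ∕ `sorry`); lane `--kind proof --supports stmt-HodgeConjecture-24833 --as helper` (count-neutral; closes no socket).
THE MATHEMATICS ([DeitmarEchterhoff2014, Prop. 6.2.1]; [MoeglinWaldspurger1995, II.2.4]).  (§1, abstract Hilbert space) If `R† = R′` and `R′` permutes the generators of `Θ = closure span {x_i}`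
(`R′ x_i = x_{τ′ i}`), then `R†(Θ) ⊆ Θ` (★ B2 §0); in particular for SELF-ADJOINT `R` with `R x_i = x_{τ i}`.  (§2, any `AdelicGroupData`) For a symmetric real test function `η`
(`η(g⁻¹) = η(g)`, `conj η = η`) and an inversion-invariant `ν`, `R(η)† = R(η)` (★), so **`hadjΘ` follows from the generator relation `R(η) x_i = x_{τ i}` alone** (E1: ★ B1 per generator) —
the shape consumed by ★ `hU_offDual_global_cm_two` ∕ ★ `modelMap_map_eq_of_on_closedSpan`.
* §1 **`adjoint_mem_closedSpan_of_generators`**, `adjoint_mem_closedSpan_of_selfAdjoint`.  * §2 **`hadjΘ_of_symm`** (any `𝒢`, in particular `U(1,1)_{L∕L⁺}`).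
HONEST LABEL.  Count-neutral helper; proves no printed statement.  HC_CM is proved only modulo the 7 printed citations (2 remaining named inputs: hLiu418 = `stmt-HodgeConjecture-24832`, h413 =
`stmt-HodgeConjecture-24833`) until rung 0 closes.

## References
* [DeitmarEchterhoff2014] A. Deitmar, S. Echterhoff, *Principles of Harmonic Analysis*, 2nd ed. (2014), Prop. 6.2.1.
* [MoeglinWaldspurger1995] C. Mœglin, J.-L. Waldspurger, *Spectral decomposition and Eisenstein series* (1995), II.2.4.
-/

set_option autoImplicit false
-- the mandated namespace repeats `HodgeConjecture.HodgeConjecture`, as in every `Theorems/*.lean` of this sub-problem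
set_option linter.dupNamespace false

noncomputable section

open MeasureTheory MeasureTheory.Measure Set Submodule CompactlySupported
open scoped ComplexConjugate
open Literature.NumberTheory.Automorphic AdelicGroupData ContRepresentation
open Summit.HodgeConjecture.HodgeConjecture.Cruxes.H413.K2E1ChiSectionHeckeIntertwiningCMTwo (apply_mem_topologicalClosure_span_of_generators)
open Summit.HodgeConjecture.HodgeConjecture.Cruxes.H413.K2E1BLUniquenessSelfAdjointU2 (adjoint_integratedOperator_rightRegular_of_symm)

namespace Summit.HodgeConjecture.HodgeConjecture.Cruxes.H413.K2E1HeckeAdjointStableCMTwo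

/-! ## §1 Abstract -/

section Abstract

variable {ι H : Type*} [NormedAddCommGroup H] [InnerProductSpace ℂ H] [CompleteSpace H]

/-- **`R†(Θ) ⊆ Θ` FROM THE GENERATOR RELATION OF `R† = R′`**: `R′ x_i = x_{τ′ i}` ⟹ `R† v ∈ Θ` for `v ∈ Θ = closure span {x_i}`. [cite: MoeglinWaldspurger1995, II.2.4] -/
theorem adjoint_mem_closedSpan_of_generators (x : ι → H) (R R' : H →L[ℂ] H) (hadj : ContinuousLinearMap.adjoint R = R') (τ' : ι → ι) (hR' : ∀ i, R' (x i) = x (τ' i))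
    (v : H) (hv : v ∈ (span ℂ (Set.range x)).topologicalClosure) : ContinuousLinearMap.adjoint R v ∈ (span ℂ (Set.range x)).topologicalClosure := by
  rw [hadj]
  exact apply_mem_topologicalClosure_span_of_generators x R' τ' hR' hv

/-- The self-adjoint case: `R† = R`, `R x_i = x_{τ i}` ⟹ `R†(Θ) ⊆ Θ`. [cite: MoeglinWaldspurger1995, II.2.4] -/
theorem adjoint_mem_closedSpan_of_selfAdjoint (x : ι → H) (R : H →L[ℂ] H) (hadj : ContinuousLinearMap.adjoint R = R) (τ : ι → ι) (hR : ∀ i, R (x i) = x (τ i))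
    (v : H) (hv : v ∈ (span ℂ (Set.range x)).topologicalClosure) : ContinuousLinearMap.adjoint R v ∈ (span ℂ (Set.range x)).topologicalClosure :=
  adjoint_mem_closedSpan_of_generators x R R hadj τ hR v hv

end Abstract

/-! ## §2 `hadjΘ` for a symmetric real test function -/

section Symm

variable {K : Type} [Field K] [NumberField K] (𝒢 : AdelicGroupData.{0} K)
  (μ : Measure 𝒢.automorphicQuotient) [𝒢.IsAutomorphicMeasure μ]
  [MeasurableSpace 𝒢.Adelic] [BorelSpace 𝒢.Adelic] (ν : Measure 𝒢.Adelic) [IsFiniteMeasureOnCompacts ν] [ν.IsInvInvariant]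

/-- **`hadjΘ` PAID for symmetric real `η`**: `η(g⁻¹) = η(g)`, `conj η = η`, and the generator relation `R(η) x_i = x_{τ i}` on `Θ = closure span {x_i} ≤ L²(X)` ⟹ `R(η)†(Θ) ⊆ Θ` — the letter
of ★ `hU_offDual_global_cm_two` (E1: `x_i = [θ_{f_i,φ_i}]`, `τ` the smoothing-profile shift, ★ B1). [cite: DeitmarEchterhoff2014, Prop. 6.2.1] [cite: MoeglinWaldspurger1995, II.2.4] -/
theorem hadjΘ_of_symm (η : C_c(𝒢.Adelic, ℂ)) (hsymm : ∀ g, η g⁻¹ = η g) (hreal : ∀ g, conj (η g) = η g)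
    {ι : Type*} (x : ι → Lp ℂ 2 μ) (τ : ι → ι)
    (hR : ∀ i, (𝒢.rightRegular μ).integratedOperator (𝒢.isUnitary_rightRegular μ) (𝒢.isStronglyContinuous_rightRegular_holds μ) ν η (x i) = x (τ i))
    (v : Lp ℂ 2 μ) (hv : v ∈ (span ℂ (Set.range x)).topologicalClosure) :
    ContinuousLinearMap.adjoint ((𝒢.rightRegular μ).integratedOperator (𝒢.isUnitary_rightRegular μ) (𝒢.isStronglyContinuous_rightRegular_holds μ) ν η) v ∈
      (span ℂ (Set.range x)).topologicalClosure :=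
  adjoint_mem_closedSpan_of_selfAdjoint x _ (adjoint_integratedOperator_rightRegular_of_symm 𝒢 μ ν η hsymm hreal) τ hR v hv

end Symm

end Summit.HodgeConjecture.HodgeConjecture.Cruxes.H413.K2E1HeckeAdjointStableCMTwo

end
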